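import Literature.Probability.RandomPlanarGeometry.SAWKestenRatioExplicit
import Literature.Probability.RandomPlanarGeometry.SAWRatioRateUpperCubeRoot
import HarnessLib

/-!
# Kesten's ratio rate from an envelope, lattice-free: two-step and ONE-step forms

Topic `Literature/Probability/RandomPlanarGeometry`. Sources: N. Madras, G. Slade, *The Self-Avoiding Walk* (1993),
§7.3, Lemma 7.3.1 (iteration of the additive inequality (7.3.3) `φ_{n+2} ≥ φ_n − B/n`) and §7.5, eq. (7.5.1)
(Kesten's rate `|c_{N+2}/c_N − μ²| ≤ K N^{-1/3}` on `ℤ^d`; H. Kesten, J. Math. Phys. 4 (1963) 960–969; printed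
without proof), p. 244 Remark (the one-step ratio `c_{N+1}/c_N → μ` on non-bipartite lattices such as `𝕋`).
Lane «pcv-sawmu», doors «HEX-RATIO-2-RATE» (two-step, `ℍ`) and «TRI-RATIO-RATE» (one-step, `𝕋`): the ABSTRACT
real-analysis layer both instantiate (no lattice content in this file).

For a positive sequence `c` with a lower bound `μ^n ≤ c_n` (`μ ≥ 1`) and a Hammersley–Welsh-type envelope
`c_n ≤ A e^{K√n} μ^n`, Kesten's inequality gives a RATE by the tree's quantitative Lemma 7.3.1
(`Zd.KestenRate.upper_dev` / `lower_dev`: exponent `1/4` on both sides from the long-length envelope) and, with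
submultiplicativity `c_{n+m} ≤ c_n c_m`, the exponent `1/3` on the upper side (`Zd.KestenRateUpper.upper_rate_cubeRoot_sub`).

* `kesten733_of_eventually` — (7.3.4) `φ_n² − D/n ≤ φ_n φ_{n+s}` for `n ≥ N₀` and `p ≤ φ ≤ P` give (7.3.3)
  `φ_n − B/n ≤ φ_{n+s}` for ALL `n ≥ 1` (`B = max D 0/p + P N₀`; any shift `s`).
* TWO-STEP (`φ_N = c_{N+2}/c_N → μ²`): `abs_ratio_sub_sq_le` (`|φ_N − μ²| ≤ μ √(12 B (g₀ + g₁√(2N) + 1)/N)` from the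
  envelope `e^{g₀ + g₁√n}`), `abs_ratio_sub_sq_le_rpow` (`≤ K' N^{-1/4}`), `ratio_rate_mixed`
  (`−K' N^{-1/4} ≤ φ_N − μ² ≤ K' N^{-1/3}` with submultiplicativity).
* ONE-STEP (`φ_N = c_{N+1}/c_N → μ`), by CEILING DOUBLING `a_k := c_{⌈k/2⌉}`, `μ_a := √μ` (`a_{n+2}/a_n = φ_{⌈n/2⌉}`;
  `⌈·⌉`, not `⌊·⌋`, keeps `μ_a^k ≤ a_k`): `abs_ratio_sub_le_oneStep` (`|φ_N − μ| ≤ K' N^{-1/4}`),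
  `ratio_rate_mixed_oneStep` (`−K' N^{-1/4} ≤ φ_N − μ ≤ K' N^{-1/3}`), and `ratio_rate_mixed_oneStep_of_eventually`
  (from the `∃ D, ∀ᶠ N` form of Kesten's inequality plus `c_n ≤ c_{n+1} ≤ 5μ c_n`).
-/

noncomputable section

open Filter Topology Finset

namespace Literature.Probability.RandomPlanarGeometry.SAW.Zd.KestenRateEnv

/-! ### Elementary inequalities (local copies of the private helpers of `SAWKestenRatioExplicit`) -/

/-- `log(1 + x) ≥ x/3` on `[0, 2]`. [folklore] -/
private theorem log_one_add_ge {x : ℝ} (hx0 : 0 ≤ x) (hx2 : x ≤ 2) : x / 3 ≤ Real.log (1 + x) := by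
  have h := Real.one_sub_inv_le_log_of_pos (show 0 < 1 + x by linarith)
  have e : 1 - (1 + x)⁻¹ = x / (1 + x) := by field_simp; ring
  rw [e] at h
  have h2 : x / 3 ≤ x / (1 + x) := div_le_div_of_nonneg_left hx0 (by linarith) (by linarith)
  linarith

/-- `−log(1 − x) ≥ x` for `x < 1`. [folklore] -/
private theorem neg_log_one_sub_ge {x : ℝ} (hx : x < 1) : x ≤ -Real.log (1 - x) := by
  have h := Real.log_le_sub_one_of_pos (show 0 < 1 - x by linarith)
  linarith

/-- The algebra of the last step: from `(uN/(kB) − 1)·(u/(lμ²)) ≤ G` (`k,l > 0`) to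
`u² N ≤ k l B μ² G + k B u`. [folklore] -/
private theorem sq_mul_le_of {u N B μ G k l : ℝ} (hB : 0 < B) (hμ : 0 < μ) (hk : 0 < k) (hl : 0 < l)
    (h : (u * N / (k * B) - 1) * (u / (l * μ ^ 2)) ≤ G) :
    u ^ 2 * N ≤ k * l * B * μ ^ 2 * G + k * B * u := by
  have hden : 0 < k * B * (l * μ ^ 2) := by positivity
  have e : (u * N / (k * B) - 1) * (u / (l * μ ^ 2)) = (u ^ 2 * N - k * B * u) / (k * B * (l * μ ^ 2)) := by
    field_simp
  rw [e, div_le_iff₀ hden] at h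
  nlinarith

/-- The square-root envelope rate as a power of `N`: `μ √(12 B (g₀ + g₁ √(2N) + 1)/N) ≤ K' · N^{-1/4}` with
`K' = μ √(12 B (g₀ + 1 + g₁ √2))`, for `N ≥ 1`. [folklore] -/
private theorem sqrt_envelope_le_rpow {μ B g₀ g₁ : ℝ} (hμ : 0 ≤ μ) (hB : 0 ≤ B) (hg₀ : 0 ≤ g₀) (hg₁ : 0 ≤ g₁)
    {N : ℕ} (hN : 1 ≤ N) :
    μ * Real.sqrt (12 * B * (g₀ + g₁ * Real.sqrt (2 * N) + 1) / N) ≤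
      μ * Real.sqrt (12 * B * (g₀ + 1 + g₁ * Real.sqrt 2)) * (N : ℝ) ^ (-(1 : ℝ) / 4) := by
  have hN1 : (1 : ℝ) ≤ N := by exact_mod_cast hN
  have hN0 : (0 : ℝ) < N := by linarith
  have hsN1 : 1 ≤ Real.sqrt N := by rw [Real.le_sqrt (by norm_num) hN0.le]; simpa using hN1
  have hrpow : (N : ℝ) ^ (-(1 : ℝ) / 4) = Real.sqrt (Real.sqrt N / N) := by
    have e1 : Real.sqrt N / N = (N : ℝ) ^ (-(1 : ℝ) / 2) := by
      rw [Real.sqrt_eq_rpow, div_eq_mul_inv, ← Real.rpow_neg_one, ← Real.rpow_add hN0]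
      norm_num
    rw [e1, Real.sqrt_eq_rpow, ← Real.rpow_mul hN0.le]
    norm_num
  have hs2N : Real.sqrt (2 * N) = Real.sqrt 2 * Real.sqrt N := Real.sqrt_mul (by norm_num) _
  have h1 : g₀ + g₁ * (Real.sqrt 2 * Real.sqrt N) + 1 ≤ (g₀ + 1 + g₁ * Real.sqrt 2) * Real.sqrt N := by
    have : 0 ≤ g₁ * Real.sqrt 2 := by positivity
    nlinarith
  have key : 12 * B * (g₀ + g₁ * Real.sqrt (2 * N) + 1) ≤ 12 * B * (g₀ + 1 + g₁ * Real.sqrt 2) * Real.sqrt N := by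
    rw [hs2N]
    calc 12 * B * (g₀ + g₁ * (Real.sqrt 2 * Real.sqrt N) + 1)
        ≤ 12 * B * ((g₀ + 1 + g₁ * Real.sqrt 2) * Real.sqrt N) := mul_le_mul_of_nonneg_left h1 (by positivity)
      _ = 12 * B * (g₀ + 1 + g₁ * Real.sqrt 2) * Real.sqrt N := by ring
  have key' : 12 * B * (g₀ + g₁ * Real.sqrt (2 * N) + 1) / N ≤
      12 * B * (g₀ + 1 + g₁ * Real.sqrt 2) * (Real.sqrt N / N) := by
    rw [← mul_div_assoc]
    exact div_le_div_of_nonneg_right key hN0.le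
  rw [hrpow]
  calc μ * Real.sqrt (12 * B * (g₀ + g₁ * Real.sqrt (2 * N) + 1) / N)
      ≤ μ * Real.sqrt (12 * B * (g₀ + 1 + g₁ * Real.sqrt 2) * (Real.sqrt N / N)) :=
        mul_le_mul_of_nonneg_left (Real.sqrt_le_sqrt key') hμ
    _ = μ * Real.sqrt (12 * B * (g₀ + 1 + g₁ * Real.sqrt 2)) * Real.sqrt (Real.sqrt N / N) := by
        rw [Real.sqrt_mul (by positivity)]; ring

/-- `(k N)^{-e} ≤ N^{-e}` for `k ≥ 1`, `e ≥ 0`, `N ≥ 1`. [folklore] -/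
private theorem rpow_mul_natCast_le {k : ℝ} (hk : 1 ≤ k) {e : ℝ} (he : e ≤ 0) {N : ℕ} (hN : 1 ≤ N) :
    (k * N : ℝ) ^ e ≤ (N : ℝ) ^ e := by
  have hN0 : (0 : ℝ) < N := by exact_mod_cast hN
  exact Real.rpow_le_rpow_of_nonpos hN0 (by nlinarith) he

/-! ### From (7.3.4) eventually to (7.3.3) for all `n ≥ 1` -/

/-- If `φ_n² − D/n ≤ φ_n φ_{n+s}` for `n ≥ N₀` and `p ≤ φ_n ≤ P` for all `n` (`0 < p`), then
`φ_n − B/n ≤ φ_{n+s}` for ALL `n ≥ 1` with `B = max D 0 / p + P N₀` (small `n` are absorbed: `φ_n ≤ P ≤ P N₀/n`).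
Any shift `s` (`s = 1`: the one-step ratio on `𝕋`; `s = 2`: the two-step ratio).
[cite: MadrasSlade1993, Lemma 7.3.1, (7.3.3)–(7.3.4)] -/
theorem kesten733_of_eventually {φ : ℕ → ℝ} {D p P : ℝ} {N₀ s : ℕ} (hp : 0 < p)
    (hlo : ∀ n, p ≤ φ n) (hhi : ∀ n, φ n ≤ P)
    (hK : ∀ n, N₀ ≤ n → φ n ^ 2 - D / n ≤ φ n * φ (n + s)) {n : ℕ} (hn : 1 ≤ n) :
    φ n - (max D 0 / p + P * N₀) / n ≤ φ (n + s) := by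
  have hn0 : (0 : ℝ) < n := by exact_mod_cast hn
  have hφ0 : 0 < φ n := lt_of_lt_of_le hp (hlo n)
  have hP : 0 < P := lt_of_lt_of_le hφ0 (hhi n)
  have hD0 : 0 ≤ max D 0 := le_max_right _ _
  rcases le_or_gt N₀ n with h | h
  · have h1 := hK n h
    have h2 : φ n - D / (n * φ n) ≤ φ (n + s) := by
      have e : φ n - D / (n * φ n) = (φ n ^ 2 - D / n) / φ n := by field_simp
      rw [e, div_le_iff₀ hφ0]
      nlinarith
    have h3 : D / (n * φ n) ≤ max D 0 / (n * p) := by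
      calc D / (n * φ n) ≤ max D 0 / (n * φ n) := div_le_div_of_nonneg_right (le_max_left _ _) (by positivity)
        _ ≤ max D 0 / (n * p) := div_le_div_of_nonneg_left hD0 (by positivity)
            (mul_le_mul_of_nonneg_left (hlo n) hn0.le)
    have h4 : max D 0 / (n * p) ≤ (max D 0 / p + P * N₀) / n := by
      rw [div_le_div_iff₀ (by positivity) hn0]
      have e : (max D 0 / p + P * N₀) * (n * p) = max D 0 * n + P * N₀ * n * p := by
        field_simp
      rw [e]
      have : 0 ≤ P * N₀ * n * p := by positivity
      linarith
    linarith
  · have hφ2 : 0 < φ (n + s) := lt_of_lt_of_le hp (hlo _)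
    have h1 : (n : ℝ) ≤ N₀ := by exact_mod_cast h.le
    have h2 : φ n ≤ (max D 0 / p + P * N₀) / n := by
      rw [le_div_iff₀ hn0]
      have : 0 ≤ max D 0 / p := by positivity
      nlinarith [hhi n]
    linarith

/-! ### Two-step rate from (7.3.3) and a `√n`-envelope -/

/-- **Quantitative Lemma 7.3.1, two-sided, with a square-root envelope** (abstract): for a positive sequence `c`
with `μ^n ≤ c_n ≤ e^{g₀ + g₁ √n} μ^n` (`μ ≥ 1`, `g₀, g₁ ≥ 0`), Kesten's additive inequality (7.3.3)
`c_{n+2}/c_n − B/n ≤ c_{n+4}/c_{n+2}` for all `n ≥ 1` (`B ≥ 5μ²`) and `c_{n+2} ≤ 5μ² c_n`, for every `N ≥ 1`: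
`|c_{N+2}/c_N − μ²| ≤ μ √(12 B (g₀ + g₁ √(2N) + 1)/N)` — forward/backward iteration over `≍ uN/B` blocks
(`Zd.KestenRate.upper_dev` / `lower_dev`). [cite: MadrasSlade1993, Lemma 7.3.1 (proof) and §7.5 eq. (7.5.1)] -/
theorem abs_ratio_sub_sq_le {c : ℕ → ℝ} {μ B g₀ g₁ : ℝ} (hc : ∀ n, 0 < c n) (hμ1 : 1 ≤ μ) (hB5 : 5 * μ ^ 2 ≤ B)
    (hg₀ : 0 ≤ g₀) (hg₁ : 0 ≤ g₁)
    (hK : ∀ n : ℕ, 1 ≤ n → c (n + 2) / c n - B / n ≤ c (n + 4) / c (n + 2))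
    (hlo : ∀ n, μ ^ n ≤ c n) (hhi : ∀ n, c n ≤ Real.exp (g₀ + g₁ * Real.sqrt n) * μ ^ n)
    (hφ : ∀ n, c (n + 2) ≤ 5 * μ ^ 2 * c n) {N : ℕ} (hN : 1 ≤ N) :
    |c (N + 2) / c N - μ ^ 2| ≤ μ * Real.sqrt (12 * B * (g₀ + g₁ * Real.sqrt (2 * N) + 1) / N) := by
  set G : ℕ → ℝ := fun n => g₀ + g₁ * Real.sqrt n with hGdef
  have hμ : 0 < μ := by linarith
  have hμ2 : 1 ≤ μ ^ 2 := by nlinarith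
  have hB0 : 0 < B := by nlinarith
  have hN0 : (0 : ℝ) < N := by exact_mod_cast hN
  have hhi' : ∀ n, c n ≤ Real.exp (G n) * μ ^ n := hhi
  have hG0 : ∀ n, 0 ≤ G n := fun n => by simp only [hGdef]; positivity
  have hGmono : ∀ {n m : ℕ}, n ≤ m → G n ≤ G m := fun {n m} hnm => by
    simp only [hGdef]
    have : Real.sqrt n ≤ Real.sqrt m := Real.sqrt_le_sqrt (by exact_mod_cast hnm)
    nlinarith
  have hG2N : G (2 * N) = g₀ + g₁ * Real.sqrt (2 * N) := by simp only [hGdef]; push_cast; ring_nf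
  set φ := c (N + 2) / c N with hφdef
  have hφ5 : φ ≤ 5 * μ ^ 2 := by rw [hφdef, div_le_iff₀ (hc N)]; exact hφ N
  have hφ0 : 0 < φ := div_pos (hc _) (hc _)
  set R := μ * Real.sqrt (12 * B * (G (2 * N) + 1) / N) with hRdef
  have hR_of_sq : ∀ u : ℝ, 0 ≤ u → u ^ 2 * N ≤ 12 * B * μ ^ 2 * (G (2 * N) + 1) → u ≤ R := by
    intro u hu0 h
    rw [hRdef]
    have e : μ * Real.sqrt (12 * B * (G (2 * N) + 1) / N) =
        Real.sqrt (μ ^ 2 * (12 * B * (G (2 * N) + 1) / N)) := by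
      rw [Real.sqrt_mul' _ (by positivity), Real.sqrt_sq hμ.le]
    rw [e, Real.le_sqrt hu0 (by positivity), ← mul_div_assoc, le_div_iff₀ hN0]
    linarith [h]
  rw [← hG2N]
  show |φ - μ ^ 2| ≤ R
  rcases lt_trichotomy φ (μ ^ 2) with hlt | heq | hgt
  · -- lower deviation
    set u := μ ^ 2 - φ with hudef
    have hu : 0 < u := by rw [hudef]; linarith
    have huμ : u < μ ^ 2 := by rw [hudef]; linarith
    rw [abs_sub_comm, abs_of_pos (by linarith : 0 < μ ^ 2 - φ)]
    set M := ⌊u * N / (4 * B)⌋₊ with hMdef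
    have hMle : (M : ℝ) ≤ u * N / (4 * B) := Nat.floor_le (by positivity)
    have hMge : u * N / (4 * B) - 1 ≤ M := by
      have := Nat.lt_floor_add_one (u * N / (4 * B)); rw [← hMdef] at this; linarith
    have h4M : 4 * (M : ℝ) ≤ N := by
      have : u * N / (4 * B) ≤ N / 4 := by
        rw [div_le_div_iff₀ (by positivity) (by norm_num)]; nlinarith
      linarith
    have h4Mn : 4 * M ≤ N := by exact_mod_cast h4M
    set N' := N - 2 * M with hN'def
    have hN'1 : 1 ≤ N' := by omega
    have h2M : 2 * M ≤ N' := by omega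
    have hNN : N' + 2 * M = N := by omega
    have hdev : c (N' + 2 * M + 2) / c (N' + 2 * M) ≤ μ ^ 2 - u := by rw [hNN, ← hφdef, hudef]; linarith
    have hM4 : 4 * (M : ℝ) * B ≤ u * ((N' : ℝ) + 2 * M) := by
      have e : ((N' : ℝ) + 2 * M) = N := by exact_mod_cast hNN
      rw [e]
      have := mul_le_mul_of_nonneg_right hMle (show (0:ℝ) ≤ 4 * B by positivity)
      rw [div_mul_cancel₀ _ (by positivity)] at this
      linarith
    have hld := Zd.KestenRate.lower_dev hc hμ hB0.le hK hlo hhi' hN'1 h2M hu hdev hM4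
    have hx1 : u / (2 * μ ^ 2) < 1 := by rw [div_lt_one (by positivity)]; nlinarith
    have hx0 : 0 ≤ u / (2 * μ ^ 2) := by positivity
    have hlog := neg_log_one_sub_ge hx1
    have hGm : G N' ≤ G (2 * N) := hGmono (by omega)
    have h1 : (M : ℝ) * (u / (2 * μ ^ 2)) ≤ G (2 * N) := by
      have := mul_le_mul_of_nonneg_left hlog (Nat.cast_nonneg M)
      linarith
    have h2 : (u * N / (4 * B) - 1) * (u / (2 * μ ^ 2)) ≤ G (2 * N) := by
      rcases le_or_gt 0 (u * N / (4 * B) - 1) with hpos | hneg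
      · exact (mul_le_mul_of_nonneg_right hMge hx0).trans h1
      · exact (mul_nonpos_of_nonpos_of_nonneg hneg.le hx0).trans (hG0 _)
    have h3 := sq_mul_le_of hB0 hμ (by norm_num : (0:ℝ) < 4) (by norm_num : (0:ℝ) < 2) h2
    refine hR_of_sq u hu.le ?_
    have h4 : B * u ≤ B * (3 * μ ^ 2) := mul_le_mul_of_nonneg_left (by nlinarith) hB0.le
    have h5 : 0 ≤ B * μ ^ 2 * G (2 * N) := by have := hG0 (2 * N); positivity
    have e3 : (4 : ℝ) * 2 * B * μ ^ 2 * G (2 * N) + 4 * B * u = 8 * (B * μ ^ 2 * G (2 * N)) + 4 * (B * u) := by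
      ring
    have e4 : (12 : ℝ) * B * μ ^ 2 * (G (2 * N) + 1) = 12 * (B * μ ^ 2 * G (2 * N)) + 4 * (B * (3 * μ ^ 2)) := by
      ring
    rw [e3] at h3; rw [e4]
    linarith
  · rw [heq, sub_self, abs_zero]; positivity
  · -- upper deviation
    set u := φ - μ ^ 2 with hudef
    have hu : 0 < u := by rw [hudef]; linarith
    have hu4 : u ≤ 4 * μ ^ 2 := by rw [hudef]; linarith
    rw [abs_of_pos (by linarith : 0 < φ - μ ^ 2)]
    set M := ⌊u * N / (2 * B)⌋₊ with hMdef
    have hMle : (M : ℝ) ≤ u * N / (2 * B) := Nat.floor_le (by positivity)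
    have hMge : u * N / (2 * B) - 1 ≤ M := by
      have := Nat.lt_floor_add_one (u * N / (2 * B)); rw [← hMdef] at this; linarith
    have h2M : 2 * (M : ℝ) ≤ N := by
      have : u * N / (2 * B) ≤ N / 2 := by
        rw [div_le_div_iff₀ (by positivity) (by norm_num)]; nlinarith
      linarith
    have h2Mn : 2 * M ≤ N := by exact_mod_cast h2M
    have hdev : μ ^ 2 + u ≤ c (N + 2) / c N := by rw [← hφdef, hudef]; linarith
    have hMB : (M : ℝ) * B ≤ u * N / 2 := by
      have h1 := mul_le_mul_of_nonneg_right hMle hB0.le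
      have e : u * N / (2 * B) * B = u * N / 2 := by field_simp
      rw [e] at h1; exact h1
    have hud := Zd.KestenRate.upper_dev hc hμ hB0.le hK hlo hhi' hN hu hdev hMB
    have hx0 : 0 ≤ u / (2 * μ ^ 2) := by positivity
    have hx2 : u / (2 * μ ^ 2) ≤ 2 := by rw [div_le_iff₀ (by positivity)]; nlinarith
    have hlog := log_one_add_ge hx0 hx2
    have hGm : G (N + 2 * M) ≤ G (2 * N) := hGmono (by omega)
    have h1 : (M : ℝ) * (u / (2 * μ ^ 2) / 3) ≤ G (2 * N) := by
      have := mul_le_mul_of_nonneg_left hlog (Nat.cast_nonneg M)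
      linarith
    have h2 : (u * N / (2 * B) - 1) * (u / (6 * μ ^ 2)) ≤ G (2 * N) := by
      have e : u / (6 * μ ^ 2) = u / (2 * μ ^ 2) / 3 := by field_simp; ring
      rw [e]
      rcases le_or_gt 0 (u * N / (2 * B) - 1) with hpos | hneg
      · exact (mul_le_mul_of_nonneg_right hMge (by positivity)).trans h1
      · exact (mul_nonpos_of_nonpos_of_nonneg hneg.le (by positivity)).trans (hG0 _)
    have h3 := sq_mul_le_of hB0 hμ (by norm_num : (0:ℝ) < 2) (by norm_num : (0:ℝ) < 6) h2
    refine hR_of_sq u hu.le ?_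
    have h4 : B * u ≤ B * (4 * μ ^ 2) := mul_le_mul_of_nonneg_left hu4 hB0.le
    have h5 : 0 ≤ B * μ ^ 2 * G (2 * N) := by have := hG0 (2 * N); positivity
    have h6 : 0 ≤ B * μ ^ 2 := by positivity
    have e3 : (2 : ℝ) * 6 * B * μ ^ 2 * G (2 * N) + 2 * B * u = 12 * (B * μ ^ 2 * G (2 * N)) + 2 * (B * u) := by
      ring
    have e4 : (12 : ℝ) * B * μ ^ 2 * (G (2 * N) + 1) = 12 * (B * μ ^ 2 * G (2 * N)) + 12 * (B * μ ^ 2) := by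
      ring
    rw [e3] at h3; rw [e4]
    linarith

/-- The two-step rate as a power: `|c_{N+2}/c_N − μ²| ≤ K' · N^{-1/4}`, `K' = μ √(12 B (g₀ + 1 + g₁ √2))`, every
`N ≥ 1`. [cite: MadrasSlade1993, Lemma 7.3.1 (proof) and §7.5 eq. (7.5.1)] -/
theorem abs_ratio_sub_sq_le_rpow {c : ℕ → ℝ} {μ B g₀ g₁ : ℝ} (hc : ∀ n, 0 < c n) (hμ1 : 1 ≤ μ)
    (hB5 : 5 * μ ^ 2 ≤ B) (hg₀ : 0 ≤ g₀) (hg₁ : 0 ≤ g₁)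
    (hK : ∀ n : ℕ, 1 ≤ n → c (n + 2) / c n - B / n ≤ c (n + 4) / c (n + 2))
    (hlo : ∀ n, μ ^ n ≤ c n) (hhi : ∀ n, c n ≤ Real.exp (g₀ + g₁ * Real.sqrt n) * μ ^ n)
    (hφ : ∀ n, c (n + 2) ≤ 5 * μ ^ 2 * c n) {N : ℕ} (hN : 1 ≤ N) :
    |c (N + 2) / c N - μ ^ 2| ≤ μ * Real.sqrt (12 * B * (g₀ + 1 + g₁ * Real.sqrt 2)) * (N : ℝ) ^ (-(1 : ℝ) / 4) :=
  (abs_ratio_sub_sq_le hc hμ1 hB5 hg₀ hg₁ hK hlo hhi hφ hN).trans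
    (sqrt_envelope_le_rpow (by linarith) (by nlinarith) hg₀ hg₁ hN)

/-- **Two-step mixed-exponent rate** `−K' N^{-1/4} ≤ c_{N+2}/c_N − μ² ≤ K' N^{-1/3}` (every `N ≥ 1`) from (7.3.3),
the numeral envelope `μ^n ≤ c_n ≤ A e^{K√n} μ^n` (`A ≥ 1`, `K ≥ 0`) and submultiplicativity `c_{n+m} ≤ c_n c_m` (the
upper side by `Zd.KestenRateUpper.upper_rate_cubeRoot_sub` at the short length `2M`).
[cite: MadrasSlade1993, §7.5 eq. (7.5.1) and Lemma 7.3.1; eq. (1.2.3)] -/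
theorem ratio_rate_mixed {c : ℕ → ℝ} {μ B A K : ℝ} (hc : ∀ n, 0 < c n) (hμ1 : 1 ≤ μ) (hB5 : 5 * μ ^ 2 ≤ B)
    (hA : 1 ≤ A) (hK0 : 0 ≤ K)
    (hK : ∀ n : ℕ, 1 ≤ n → c (n + 2) / c n - B / n ≤ c (n + 4) / c (n + 2))
    (hlo : ∀ n, μ ^ n ≤ c n) (hhi : ∀ n, c n ≤ A * Real.exp (K * Real.sqrt n) * μ ^ n)
    (hφ : ∀ n, c (n + 2) ≤ 5 * μ ^ 2 * c n) (hsub : ∀ n m : ℕ, c (n + m) ≤ c n * c m) :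
    ∃ K' : ℝ, ∀ N : ℕ, 1 ≤ N →
      -(K' * (N : ℝ) ^ (-(1 : ℝ) / 4)) ≤ c (N + 2) / c N - μ ^ 2 ∧
        c (N + 2) / c N - μ ^ 2 ≤ K' * (N : ℝ) ^ (-(1 : ℝ) / 3) := by
  have hμ : 0 < μ := by linarith
  have hB1 : 1 ≤ B := by nlinarith
  have hg₀ : 0 ≤ Real.log A := Real.log_nonneg hA
  have hhi' : ∀ n, c n ≤ Real.exp (Real.log A + K * Real.sqrt n) * μ ^ n := fun n => by
    rw [Real.exp_add, Real.exp_log (by linarith)]; exact hhi n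
  -- lower side (exponent 1/4)
  set K₁ := μ * Real.sqrt (12 * B * (Real.log A + 1 + K * Real.sqrt 2)) with hK₁
  have hlow : ∀ N : ℕ, 1 ≤ N → |c (N + 2) / c N - μ ^ 2| ≤ K₁ * (N : ℝ) ^ (-(1 : ℝ) / 4) := fun N hN =>
    abs_ratio_sub_sq_le_rpow hc hμ1 hB5 hg₀ hK0 hK hlo hhi' hφ hN
  -- upper side (exponent 1/3): submultiplicativity at the short length `2M`
  have hsub' : ∀ N M : ℕ, c (N + 2 * M) ≤ c N * c (2 * M) := fun N M => hsub N (2 * M)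
  have hhi₂ : ∀ M : ℕ, c (2 * M) ≤ A * Real.exp (K * Real.sqrt 2 * Real.sqrt M) * μ ^ (2 * M) := by
    intro M
    have h := hhi (2 * M)
    have e : Real.sqrt ((2 * M : ℕ) : ℝ) = Real.sqrt 2 * Real.sqrt M := by
      push_cast; exact Real.sqrt_mul (by norm_num) _
    rw [e, ← mul_assoc] at h
    exact h
  obtain ⟨K₂, hK₂⟩ := Zd.KestenRateUpper.upper_rate_cubeRoot_sub hc hμ1 hB1 hA hK hsub' hhi₂
  refine ⟨max K₁ (max K₂ 0), fun N hN => ⟨?_, ?_⟩⟩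
  · have h1 := hlow N hN
    have hr : 0 ≤ (N : ℝ) ^ (-(1 : ℝ) / 4) := Real.rpow_nonneg (Nat.cast_nonneg N) _
    have h2 : K₁ * (N : ℝ) ^ (-(1 : ℝ) / 4) ≤ max K₁ (max K₂ 0) * (N : ℝ) ^ (-(1 : ℝ) / 4) :=
      mul_le_mul_of_nonneg_right (le_max_left _ _) hr
    have := (abs_le.1 h1).1
    linarith
  · have hr : 0 ≤ (N : ℝ) ^ (-(1 : ℝ) / 3) := Real.rpow_nonneg (Nat.cast_nonneg N) _
    rcases le_or_gt (c (N + 2) / c N - μ ^ 2) 0 with hle | hgt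
    · exact hle.trans (mul_nonneg (le_trans (le_max_right _ _) (le_max_right _ _)) hr)
    · have hdev : μ ^ 2 + (c (N + 2) / c N - μ ^ 2) ≤ c (N + 2) / c N := by linarith
      calc c (N + 2) / c N - μ ^ 2 ≤ K₂ * (N : ℝ) ^ (-(1 : ℝ) / 3) := hK₂ N hN _ hgt hdev
        _ ≤ max K₁ (max K₂ 0) * (N : ℝ) ^ (-(1 : ℝ) / 3) :=
            mul_le_mul_of_nonneg_right ((le_max_left _ _).trans (le_max_right _ _)) hr

/-! ### ONE-step rate by ceiling doubling -/

section OneStep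

variable {c : ℕ → ℝ} {μ B A K : ℝ}

/-- The hypotheses of the two-step lemmas for the doubled sequence `a_k = c_{⌈k/2⌉} = c_{(k+1)/2}`, `μ_a = √μ`.
[cite: MadrasSlade1993, p. 244 Remark (one-step ratio on non-bipartite lattices)] -/
private theorem dbl_hyps {a : ℕ → ℝ} (ha : ∀ k, a k = c ((k + 1) / 2)) (hc : ∀ n, 0 < c n) (hμ1 : 1 ≤ μ)
    (hB : 0 ≤ B) (hA : 1 ≤ A) (hK0 : 0 ≤ K)
    (hK1 : ∀ n : ℕ, 1 ≤ n → c (n + 1) / c n - B / n ≤ c (n + 2) / c (n + 1))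
    (hlo : ∀ n, μ ^ n ≤ c n) (hhi : ∀ n, c n ≤ A * Real.exp (K * Real.sqrt n) * μ ^ n)
    (hφ : ∀ n, c (n + 1) ≤ 5 * μ * c n) :
    (∀ k, 0 < a k) ∧ 1 ≤ Real.sqrt μ ∧ Real.sqrt μ ^ 2 = μ ∧
    (∀ n : ℕ, 1 ≤ n → a (n + 2) / a n - (2 * B + 5 * μ) / n ≤ a (n + 4) / a (n + 2)) ∧
    (∀ k, Real.sqrt μ ^ k ≤ a k) ∧
    (∀ k, a k ≤ (A * Real.sqrt μ) * Real.exp (K * Real.sqrt k) * Real.sqrt μ ^ k) ∧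
    (∀ n, a (n + 2) ≤ 5 * Real.sqrt μ ^ 2 * a n) := by
  have hμ : 0 < μ := by linarith
  have hs1 : 1 ≤ Real.sqrt μ := by rw [Real.le_sqrt (by norm_num) hμ.le]; simpa using hμ1
  have hs0 : 0 < Real.sqrt μ := by linarith
  have hsq : Real.sqrt μ ^ 2 = μ := Real.sq_sqrt hμ.le
  have hpow : ∀ j : ℕ, Real.sqrt μ ^ (2 * j) = μ ^ j := fun j => by rw [pow_mul, hsq]
  have ha2 : ∀ n, a (n + 2) = c ((n + 1) / 2 + 1) := fun n => by rw [ha]; congr 1; omega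
  have ha4 : ∀ n, a (n + 4) = c ((n + 1) / 2 + 2) := fun n => by rw [ha]; congr 1; omega
  refine ⟨fun k => by rw [ha]; exact hc _, hs1, hsq, ?_, ?_, ?_, ?_⟩
  · -- (7.3.3) for the doubled sequence, constant `2B + 5μ`
    intro n hn
    set m := (n + 1) / 2 with hm
    have hm1 : 1 ≤ m := by omega
    have h2m : n ≤ 2 * m := by omega
    have hn0 : (0 : ℝ) < n := by exact_mod_cast hn
    have hm0 : (0 : ℝ) < m := by exact_mod_cast hm1
    have h := hK1 m hm1
    rw [ha2, ha4, ha n, ← hm, show m + 1 + 1 = m + 2 by ring]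
    have hBm : B / (m : ℝ) ≤ (2 * B + 5 * μ) / n := by
      rw [div_le_div_iff₀ hm0 hn0]
      have h2m' : (n : ℝ) ≤ 2 * m := by exact_mod_cast h2m
      nlinarith
    linarith
  · -- lower bound
    intro k
    rw [ha]
    calc Real.sqrt μ ^ k ≤ Real.sqrt μ ^ (2 * ((k + 1) / 2)) := pow_le_pow_right₀ hs1 (by omega)
      _ = μ ^ ((k + 1) / 2) := hpow _
      _ ≤ c ((k + 1) / 2) := hlo _
  · -- envelope
    intro k
    set j := (k + 1) / 2 with hj
    rw [ha, ← hj]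
    have h := hhi j
    have hjk : (j : ℝ) ≤ k := by exact_mod_cast (by omega : j ≤ k)
    have he : Real.exp (K * Real.sqrt j) ≤ Real.exp (K * Real.sqrt k) :=
      Real.exp_le_exp.2 (mul_le_mul_of_nonneg_left (Real.sqrt_le_sqrt hjk) hK0)
    have hμj : μ ^ j ≤ Real.sqrt μ * Real.sqrt μ ^ k := by
      calc μ ^ j = Real.sqrt μ ^ (2 * j) := (hpow j).symm
        _ ≤ Real.sqrt μ ^ (k + 1) := pow_le_pow_right₀ hs1 (by omega)
        _ = Real.sqrt μ * Real.sqrt μ ^ k := by rw [pow_succ]; ring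
    have hA0 : 0 ≤ A := by linarith
    calc c j ≤ A * Real.exp (K * Real.sqrt j) * μ ^ j := h
      _ ≤ A * Real.exp (K * Real.sqrt k) * (Real.sqrt μ * Real.sqrt μ ^ k) :=
          mul_le_mul (mul_le_mul_of_nonneg_left he hA0) hμj (by positivity) (by positivity)
      _ = A * Real.sqrt μ * Real.exp (K * Real.sqrt k) * Real.sqrt μ ^ k := by ring
  · intro n
    rw [ha2, hsq, ha]
    exact hφ _

/-- **One-step two-sided rate** `|c_{N+1}/c_N − μ| ≤ K' N^{-1/4}` (every `N ≥ 1`) from the one-step (7.3.3)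
`c_{n+1}/c_n − B/n ≤ c_{n+2}/c_{n+1}` (`n ≥ 1`), the envelope `μ^n ≤ c_n ≤ A e^{K√n} μ^n` (`μ, A ≥ 1`, `K ≥ 0`) and
`c_{n+1} ≤ 5μ c_n` — the two-step lemma on the doubled sequence `c_{⌈k/2⌉}` with `√μ`.
[cite: MadrasSlade1993, §7.5 eq. (7.5.1), Lemma 7.3.1 and p. 244 Remark] -/
theorem abs_ratio_sub_le_oneStep (hc : ∀ n, 0 < c n) (hμ1 : 1 ≤ μ) (hB : 0 ≤ B) (hA : 1 ≤ A) (hK0 : 0 ≤ K)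
    (hK1 : ∀ n : ℕ, 1 ≤ n → c (n + 1) / c n - B / n ≤ c (n + 2) / c (n + 1))
    (hlo : ∀ n, μ ^ n ≤ c n) (hhi : ∀ n, c n ≤ A * Real.exp (K * Real.sqrt n) * μ ^ n)
    (hφ : ∀ n, c (n + 1) ≤ 5 * μ * c n) :
    ∃ K' : ℝ, ∀ N : ℕ, 1 ≤ N → |c (N + 1) / c N - μ| ≤ K' * (N : ℝ) ^ (-(1 : ℝ) / 4) := by
  set a : ℕ → ℝ := fun k => c ((k + 1) / 2) with ha_def
  have ha : ∀ k, a k = c ((k + 1) / 2) := fun k => rfl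
  obtain ⟨ha0, hs1, hsq, hKa, hloa, hhia, hφa⟩ := dbl_hyps ha hc hμ1 hB hA hK0 hK1 hlo hhi hφ
  have hAμ : 1 ≤ A * Real.sqrt μ := one_le_mul_of_one_le_of_one_le hA hs1
  have hg₀ : 0 ≤ Real.log (A * Real.sqrt μ) := Real.log_nonneg hAμ
  have hhia' : ∀ k, a k ≤ Real.exp (Real.log (A * Real.sqrt μ) + K * Real.sqrt k) * Real.sqrt μ ^ k :=
    fun k => by rw [Real.exp_add, Real.exp_log (by linarith)]; exact hhia k
  have hB5 : 5 * Real.sqrt μ ^ 2 ≤ 2 * B + 5 * μ := by rw [hsq]; linarith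
  set K' := Real.sqrt μ * Real.sqrt (12 * (2 * B + 5 * μ) * (Real.log (A * Real.sqrt μ) + 1 + K * Real.sqrt 2))
    with hK'
  refine ⟨K' * (2 : ℝ) ^ (-(1 : ℝ) / 4), fun N hN => ?_⟩
  have h := abs_ratio_sub_sq_le_rpow ha0 hs1 hB5 hg₀ hK0 hKa hloa hhia' hφa (show 1 ≤ 2 * N by omega)
  have e1 : a (2 * N + 2) = c (N + 1) := by rw [ha]; congr 1; omega
  have e2 : a (2 * N) = c N := by rw [ha]; congr 1; omega
  rw [e1, e2, hsq] at h
  have hN0 : (0 : ℝ) ≤ N := Nat.cast_nonneg N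
  have e : ((2 * N : ℕ) : ℝ) ^ (-(1 : ℝ) / 4) = (2 : ℝ) ^ (-(1 : ℝ) / 4) * (N : ℝ) ^ (-(1 : ℝ) / 4) := by
    push_cast; exact Real.mul_rpow (by norm_num) hN0
  rw [e] at h
  calc |c (N + 1) / c N - μ| ≤ K' * ((2 : ℝ) ^ (-(1 : ℝ) / 4) * (N : ℝ) ^ (-(1 : ℝ) / 4)) := h
    _ = K' * (2 : ℝ) ^ (-(1 : ℝ) / 4) * (N : ℝ) ^ (-(1 : ℝ) / 4) := by ring

/-- **One-step mixed-exponent rate** `−K' N^{-1/4} ≤ c_{N+1}/c_N − μ ≤ K' N^{-1/3}` (every `N ≥ 1`): as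
`abs_ratio_sub_le_oneStep`, plus submultiplicativity `c_{n+m} ≤ c_n c_m` for the upper side (the doubled sequence
satisfies `a_{N+2M} ≤ a_N c_M`, short-length envelope `c_M ≤ A e^{K√M} (√μ)^{2M}`).
[cite: MadrasSlade1993, §7.5 eq. (7.5.1), Lemma 7.3.1, eq. (1.2.3) and p. 244 Remark] -/
theorem ratio_rate_mixed_oneStep (hc : ∀ n, 0 < c n) (hμ1 : 1 ≤ μ) (hB : 0 ≤ B) (hA : 1 ≤ A) (hK0 : 0 ≤ K)
    (hK1 : ∀ n : ℕ, 1 ≤ n → c (n + 1) / c n - B / n ≤ c (n + 2) / c (n + 1))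
    (hlo : ∀ n, μ ^ n ≤ c n) (hhi : ∀ n, c n ≤ A * Real.exp (K * Real.sqrt n) * μ ^ n)
    (hφ : ∀ n, c (n + 1) ≤ 5 * μ * c n) (hsub : ∀ n m : ℕ, c (n + m) ≤ c n * c m) :
    ∃ K' : ℝ, ∀ N : ℕ, 1 ≤ N →
      -(K' * (N : ℝ) ^ (-(1 : ℝ) / 4)) ≤ c (N + 1) / c N - μ ∧
        c (N + 1) / c N - μ ≤ K' * (N : ℝ) ^ (-(1 : ℝ) / 3) := by
  set a : ℕ → ℝ := fun k => c ((k + 1) / 2) with ha_def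
  have ha : ∀ k, a k = c ((k + 1) / 2) := fun k => rfl
  obtain ⟨ha0, hs1, hsq, hKa, hloa, hhia, hφa⟩ := dbl_hyps ha hc hμ1 hB hA hK0 hK1 hlo hhi hφ
  have hμ : 0 < μ := by linarith
  -- lower side
  obtain ⟨K₁, hK₁⟩ := abs_ratio_sub_le_oneStep hc hμ1 hB hA hK0 hK1 hlo hhi hφ
  -- upper side: cube-root engine on the doubled sequence with `a₂ M := c M`
  have hB1 : 1 ≤ 2 * B + 5 * μ := by linarith
  have hsub' : ∀ N M : ℕ, a (N + 2 * M) ≤ a N * c M := fun N M => by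
    have e : a (N + 2 * M) = c ((N + 1) / 2 + M) := by rw [ha]; congr 1; omega
    rw [e, ha]
    exact hsub _ _
  have hhi₂ : ∀ M : ℕ, c M ≤ A * Real.exp (K * Real.sqrt M) * Real.sqrt μ ^ (2 * M) := fun M => by
    rw [pow_mul, hsq]; exact hhi M
  obtain ⟨K₂, hK₂⟩ := Zd.KestenRateUpper.upper_rate_cubeRoot_sub ha0 hs1 hB1 hA hKa hsub' hhi₂
  refine ⟨max K₁ (max K₂ 0), fun N hN => ⟨?_, ?_⟩⟩
  · have h1 := hK₁ N hN
    have hr : 0 ≤ (N : ℝ) ^ (-(1 : ℝ) / 4) := Real.rpow_nonneg (Nat.cast_nonneg N) _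
    have h2 : K₁ * (N : ℝ) ^ (-(1 : ℝ) / 4) ≤ max K₁ (max K₂ 0) * (N : ℝ) ^ (-(1 : ℝ) / 4) :=
      mul_le_mul_of_nonneg_right (le_max_left _ _) hr
    have := (abs_le.1 h1).1
    linarith
  · have hr : 0 ≤ (N : ℝ) ^ (-(1 : ℝ) / 3) := Real.rpow_nonneg (Nat.cast_nonneg N) _
    have hK₂0 : 0 ≤ max K₂ 0 := le_max_right _ _
    rcases le_or_gt (c (N + 1) / c N - μ) 0 with hle | hgt
    · exact hle.trans (mul_nonneg (le_trans hK₂0 (le_max_right _ _)) hr)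
    · have e1 : a (2 * N + 2) = c (N + 1) := by rw [ha]; congr 1; omega
      have e2 : a (2 * N) = c N := by rw [ha]; congr 1; omega
      have hdev : Real.sqrt μ ^ 2 + (c (N + 1) / c N - μ) ≤ a (2 * N + 2) / a (2 * N) := by
        rw [e1, e2, hsq]; linarith
      have h1 := hK₂ (2 * N) (by omega) _ hgt hdev
      have h2N : ((2 * N : ℕ) : ℝ) ^ (-(1 : ℝ) / 3) ≤ (N : ℝ) ^ (-(1 : ℝ) / 3) := by
        push_cast; exact rpow_mul_natCast_le (by norm_num) (by norm_num) hN
      calc c (N + 1) / c N - μ ≤ K₂ * ((2 * N : ℕ) : ℝ) ^ (-(1 : ℝ) / 3) := h1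
        _ ≤ max K₂ 0 * ((2 * N : ℕ) : ℝ) ^ (-(1 : ℝ) / 3) :=
            mul_le_mul_of_nonneg_right (le_max_left _ _) (Real.rpow_nonneg (Nat.cast_nonneg _) _)
        _ ≤ max K₂ 0 * (N : ℝ) ^ (-(1 : ℝ) / 3) := mul_le_mul_of_nonneg_left h2N hK₂0
        _ ≤ max K₁ (max K₂ 0) * (N : ℝ) ^ (-(1 : ℝ) / 3) := mul_le_mul_of_nonneg_right (le_max_right _ _) hr

/-- **One-step mixed rate from Kesten's inequality in the `∃ D, ∀ᶠ N` form** (the shape of the lane faces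
`KestenIneqTri`): with `c_n ≤ c_{n+1} ≤ 5μ c_n` the eventual (7.3.4) becomes (7.3.3) for all `n ≥ 1`
(`kesten733_of_eventually`), and `ratio_rate_mixed_oneStep` applies.
[cite: MadrasSlade1993, §7.5 eq. (7.5.1), Lemma 7.3.1 and p. 244 Remark] -/
theorem ratio_rate_mixed_oneStep_of_eventually (hc : ∀ n, 0 < c n) (hμ1 : 1 ≤ μ) (hA : 1 ≤ A) (hK0 : 0 ≤ K)
    (hKev : ∃ D : ℝ, ∀ᶠ N : ℕ in atTop,
      (c (N + 1) / c N) ^ 2 - D / N ≤ (c (N + 1) / c N) * (c (N + 2) / c (N + 1)))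
    (hmono : ∀ n, c n ≤ c (n + 1)) (hφ : ∀ n, c (n + 1) ≤ 5 * μ * c n)
    (hlo : ∀ n, μ ^ n ≤ c n) (hhi : ∀ n, c n ≤ A * Real.exp (K * Real.sqrt n) * μ ^ n)
    (hsub : ∀ n m : ℕ, c (n + m) ≤ c n * c m) :
    ∃ K' : ℝ, ∀ N : ℕ, 1 ≤ N →
      -(K' * (N : ℝ) ^ (-(1 : ℝ) / 4)) ≤ c (N + 1) / c N - μ ∧
        c (N + 1) / c N - μ ≤ K' * (N : ℝ) ^ (-(1 : ℝ) / 3) := by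
  have hμ : 0 < μ := by linarith
  set φ : ℕ → ℝ := fun n => c (n + 1) / c n with hφdef
  have hφlo : ∀ n, (1 : ℝ) ≤ φ n := fun n => by
    simp only [hφdef]; rw [le_div_iff₀ (hc n), one_mul]; exact hmono n
  have hφhi : ∀ n, φ n ≤ 5 * μ := fun n => by
    simp only [hφdef]; rw [div_le_iff₀ (hc n)]; exact hφ n
  obtain ⟨D, hD⟩ := hKev
  obtain ⟨N₀, hN₀⟩ := eventually_atTop.1 hD
  have hK' : ∀ n, N₀ ≤ n → φ n ^ 2 - D / n ≤ φ n * φ (n + 1) := fun n hn => by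
    have := hN₀ n hn
    simp only [hφdef, show n + 1 + 1 = n + 2 by ring]
    exact this
  set B : ℝ := max D 0 / 1 + 5 * μ * N₀ with hBdef
  have hB : 0 ≤ B := by rw [hBdef]; positivity
  have hK1 : ∀ n : ℕ, 1 ≤ n → c (n + 1) / c n - B / n ≤ c (n + 2) / c (n + 1) := by
    intro n hn
    have h := kesten733_of_eventually (s := 1) (by norm_num : (0 : ℝ) < 1) hφlo hφhi hK' hn
    simp only [hφdef, show n + 1 + 1 = n + 2 by ring] at h
    rw [← hBdef] at h
    exact h
  exact ratio_rate_mixed_oneStep hc hμ1 hB hA hK0 hK1 hlo hhi hφ hsub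

end OneStep

end Literature.Probability.RandomPlanarGeometry.SAW.Zd.KestenRateEnv
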